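import Mathlib.AlgebraicGeometry.IdealSheaf.Functorial
import Literature.AlgebraicGeometry.Resolution.IdealSheafLemmas
import Summits.ResolutionOfSingularities.ResolutionOfSingularities.Theorems.WeightedInvariantWeightedConstructionStaticDefs
import Summits.ResolutionOfSingularities.ResolutionOfSingularities.Theorems.WeightedInvariantWeightedConstructionOffExceptional
import HarnessLib

/-!
# The exceptional divisor of a cobordant chart is locally principal with a regular generator

Route `ResolutionOfSingularities/WeightedInvariant`, crux `WeightedConstruction`
(stmt-ResolutionOfSingularities-0571), line `no-phi-rays-static-drop`, stub
`stub_exceptional_principal`.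

Notation: `A = Γ(Y, U)`, `I = R.chartIdeals U`, `S = A[t⁻¹, Iₙ tⁿ] = extReesAlgebra I`,
`B = Spec S = affineCobordantBlowup I ⊇ B₊ = B ∖ Vert(B) = R.cobordantPlus U` (Włodarczyk,
arXiv:2203.03090, Def. 2.3.5), `E(U) = cobordantExceptional R U` the pull-back to `B₊` of the ideal
sheaf of `(t⁻¹)` (Lemma 2.3.8), `σ = σˢ(𝔞) = extReesAlgebra.strictTransform I 𝔞` the strict
transform of `𝔞 = X(U)` (3.3.12), whose ideal sheaf restricted to `B₊` is
`R.cobordantStrictTransform U X`.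

What is proved (`stub_exceptional_principal`, registered signature): every point of `E(U)` has an
affine open neighbourhood `V` in `B₊` on which the ideal of `E(U)` is principal, `= (h)`, with `h` a
non-zero-divisor modulo the strict transform: `h a ∈ σ(V) → a ∈ σ(V)`.

How. A point of `B₊` is a prime `𝔭` of `S` off the vertex, so some `r` in the vertex ideal is not in
`𝔭`; the basic open `D(r) ⊆ B` lies in `B₊`, and `V = B₊ ∩ D(r)` is affine with
`Γ(V) ≅ Γ(B, D(r)) = S[1/r]` (`IsAffineOpen.isLocalization_basicOpen`). Along an open immersion the
ideal of a pulled-back ideal sheaf is the pulled-back ideal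
(`Scheme.IdealSheafData.ideal_comap_of_isOpenImmersion`), and on an affine scheme the ideal sheaf of
`J` has ideal `J · Γ(W)` on every affine open `W` (`ofIdealTop_ideal`): so `E(U)(V) = (t⁻¹)` and
`σ(V) = σ S[1/r]`, transported along `Γ(B, D(r)) ≅ Γ(V)`. Finally `σ` is `t⁻¹`-saturated in `S`
(`extReesAlgebra.mem_strictTransform_iff`), saturation by an element survives localisation
(`mem_map_of_mul_mem_map`) and ring isomorphisms (`mem_map_of_mul_mem_map_of_inverse`).
-/

noncomputable section

open CategoryTheory AlgebraicGeometry TopologicalSpace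
open Literature.AlgebraicGeometry.Resolution
open scoped LaurentPolynomial

set_option linter.dupNamespace false -- mandated namespace of this single-conjunct summit

namespace Summit.ResolutionOfSingularities.ResolutionOfSingularities.Theorems

universe u

namespace ExceptionalPrincipal

/-! ## Ring-level lemmas: saturation by an element survives localisation and isomorphisms -/

/-- If `σ ≤ S` is `s`-saturated (`s g ∈ σ → g ∈ σ`) and `T` is a localisation of `S`, then the
extension `σ T` is `s`-saturated. [folklore] -/
theorem mem_map_of_mul_mem_map {S T : Type*} [CommRing S] [CommRing T] [Algebra S T]
    (M : Submonoid S) [IsLocalization M T] {s : S} {σ : Ideal S}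
    (hσ : ∀ g, s * g ∈ σ → g ∈ σ) {a : T}
    (ha : algebraMap S T s * a ∈ σ.map (algebraMap S T)) : a ∈ σ.map (algebraMap S T) := by
  obtain ⟨⟨g, m⟩, hgm⟩ := IsLocalization.surj M a
  obtain ⟨⟨j, m'⟩, hj⟩ := (IsLocalization.mem_map_algebraMap_iff M T).mp ha
  -- `hgm : a * m = g`, `hj : (s * a) * m' = j` in `T`; hence `s g m' = j m` up to a factor `c ∈ M`
  have e : algebraMap S T (s * g * m') = algebraMap S T (j * m) := by
    simp only [map_mul]
    rw [← hgm, ← hj]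
    ring
  obtain ⟨c, hc⟩ := (IsLocalization.eq_iff_exists M T).mp e
  have hmem : g * (m' * c : S) ∈ σ := by
    apply hσ
    have : s * (g * (m' * c : S)) = c * (s * g * m') := by ring
    rw [this, hc]
    exact σ.mul_mem_left _ (σ.mul_mem_right _ j.2)
  rw [IsLocalization.mem_map_algebraMap_iff M T]
  refine ⟨⟨⟨_, hmem⟩, m * (m' * c)⟩, ?_⟩
  simp only [Submonoid.coe_mul, map_mul]
  rw [← hgm]
  ring

/-- Saturation by an element is transported along a ring homomorphism `φ` with a two-sided
inverse `ψ`. [folklore] -/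
theorem mem_map_of_mul_mem_map_of_inverse {C D : Type*} [CommRing C] [CommRing D] (φ : C →+* D)
    (ψ : D →+* C) (h₁ : ∀ a, ψ (φ a) = a) (h₂ : ∀ b, φ (ψ b) = b) {s : C} {σ : Ideal C}
    (hσ : ∀ g, s * g ∈ σ → g ∈ σ) (g : D) (hg : φ s * g ∈ σ.map φ) : g ∈ σ.map φ := by
  have hφ : Function.Surjective φ := fun d => ⟨ψ d, h₂ d⟩
  obtain ⟨x, hx, hxe⟩ := (Ideal.mem_map_iff_of_surjective φ hφ).mp hg
  have hx' : x = s * ψ g := by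
    rw [← h₁ x, hxe, map_mul, h₁]
  rw [hx'] at hx
  rw [← h₂ g]
  exact Ideal.mem_map_of_mem φ (hσ _ hx)

/-- The strict transform `σˢ(𝔞)` is `t⁻¹`-saturated (Włodarczyk 3.3.12: it is the
`t⁻¹`-saturation of `𝔞 · A[t⁻¹, Iₙ tⁿ]`). [cite: Wlodarczyk2022, 3.3.12] -/
theorem mem_strictTransform_of_tInv_mul_mem {A : Type u} [CommRing A] (I : ℕ → Ideal A)
    {𝔞 : Ideal A} {g : extReesAlgebra I}
    (h : extReesAlgebra.tInv I * g ∈ extReesAlgebra.strictTransform I 𝔞) :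
    g ∈ extReesAlgebra.strictTransform I 𝔞 := by
  obtain ⟨m, hm⟩ := (extReesAlgebra.mem_strictTransform_iff I).mp h
  exact (extReesAlgebra.mem_strictTransform_iff I).mpr ⟨m + 1, by rwa [pow_succ, mul_assoc]⟩

/-! ## Scheme-level lemmas -/

/-- Sections over an open that *equals* a basic open `D(r)` of an affine open `U` form the
localisation of `Γ(U)` away from `r` (transport of `IsAffineOpen.isLocalization_basicOpen` along
the equality of opens). [folklore] -/
theorem isLocalization_away_of_eq {B : Scheme.{u}} {U W : B.Opens} (hU : IsAffineOpen U)
    (r : Γ(B, U)) (hW : W = B.basicOpen r) (hWU : W ≤ U) :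
    @IsLocalization.Away Γ(B, U) _ r Γ(B, W) _ (B.presheaf.map (homOfLE hWU).op).hom.toAlgebra := by
  subst hW
  exact hU.isLocalization_basicOpen r

/-- Pulling back a principal ideal along the inverse of an isomorphism of commutative rings.
[folklore] -/
theorem comap_span_singleton_iso {C D : CommRingCat.{u}} (e : C ≅ D) (g : C) :
    (Ideal.span {g}).comap e.inv.hom = Ideal.span {e.hom.hom g} :=
  comap_span_singleton_ringEquiv e.symm.commRingCatIsoToRingEquiv g

open Scheme.IdealSheafData in
/-- **Affine form of the stub.** On an affine scheme `B` with an open `P`, elements `s, r ∈ Γ(B)`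
and an `s`-saturated ideal `σ ≤ Γ(B)` with `D(r) ⊆ P`: every point of `P` inside `D(r)` has the
affine open neighbourhood `V = P ∩ D(r)` of `P` on which the pull-back to `P` of the ideal sheaf of
`(s)` has the principal ideal generated by (the image of) `s`, and this generator is a
non-zero-divisor modulo the ideal of the pull-back of the ideal sheaf of `σ` (which is
`σ Γ(B)[1/r]`). [folklore] -/
theorem exists_affineOpens {B : Scheme.{u}} [IsAffine B] (P : B.Opens) (s r : Γ(B, ⊤))
    (σ : Ideal Γ(B, ⊤)) (hσ : ∀ g, s * g ∈ σ → g ∈ σ) (hrP : B.basicOpen r ≤ P)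
    (b : P) (hb : (b : B) ∈ B.basicOpen r) :
    ∃ V : (P : Scheme.{u}).affineOpens, (b : (P : Scheme.{u})) ∈ (V : (P : Scheme.{u}).Opens) ∧
      ∃ h : Γ(P, V), ((ofIdealTop (Ideal.span {s})).comap P.ι).ideal V = Ideal.span {h} ∧
        ∀ a : Γ(P, V), h * a ∈ ((ofIdealTop σ).comap P.ι).ideal V →
          a ∈ ((ofIdealTop σ).comap P.ι).ideal V := by
  -- the affine open `V = P ∩ D(r)` of `P`, whose image in `B` is `D(r)`
  have hWaff : IsAffineOpen (B.basicOpen r) := (isAffineOpen_top B).basicOpen r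
  have hVaff : IsAffineOpen (P.ι ⁻¹ᵁ B.basicOpen r) :=
    hWaff.preimage_of_isOpenImmersion P.ι (by rw [Scheme.Opens.opensRange_ι]; exact hrP)
  have himg : P.ι ''ᵁ (P.ι ⁻¹ᵁ B.basicOpen r) = B.basicOpen r := by
    rw [Scheme.Hom.image_preimage_eq_opensRange_inf, Scheme.Opens.opensRange_ι,
      inf_eq_right.mpr hrP]
  refine ⟨⟨P.ι ⁻¹ᵁ B.basicOpen r, hVaff⟩, hb, ?_⟩
  -- `Γ(B, D(r)) = Γ(B)[1/r]` along the restriction `ρ`, and `Γ(B, D(r)) ≅ Γ(P, V)` along `e`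
  set ρ : Γ(B, ⊤) →+* Γ(B, P.ι ''ᵁ (P.ι ⁻¹ᵁ B.basicOpen r)) :=
    (B.presheaf.map (homOfLE (le_top : P.ι ''ᵁ (P.ι ⁻¹ᵁ B.basicOpen r) ≤ ⊤)).op).hom
  set e := P.ι.appIso (P.ι ⁻¹ᵁ B.basicOpen r)
  have hloc : @IsLocalization.Away Γ(B, ⊤) _ r Γ(B, P.ι ''ᵁ (P.ι ⁻¹ᵁ B.basicOpen r)) _
      ρ.toAlgebra :=
    isLocalization_away_of_eq (isAffineOpen_top B) r himg le_top
  refine ⟨e.hom.hom (ρ s), ?_, ?_⟩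
  · rw [ideal_comap_of_isOpenImmersion, ofIdealTop_ideal, Ideal.map_span, Set.image_singleton]
    exact comap_span_singleton_iso e (ρ s)
  · intro a ha
    rw [ideal_comap_of_isOpenImmersion, ofIdealTop_ideal, Ideal.mem_comap] at ha ⊢
    rw [map_mul, CommRingCat.inv_hom_apply] at ha
    letI := ρ.toAlgebra
    haveI := hloc
    exact mem_map_of_mul_mem_map (Submonoid.powers r) hσ ha

end ExceptionalPrincipal

open ExceptionalPrincipal

/-- **The exceptional divisor `E(U)` of `B₊(U)` is locally principal with a generator regular modulo
the strict transform** (stub `stub_exceptional_principal` of line `no-phi-rays-static-drop`,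
registered signature). For a Rees algebra `R` on a scheme `Y`, an affine open `U`, an ideal sheaf
`X` and a point `x` of `E(U) = V(t⁻¹) ∩ B₊(U)`: there is an affine open `V ∋ x` of `B₊(U)` with
`E(U)(V) = (h)` and `h a ∈ X'(V) → a ∈ X'(V)` for the strict transform `X'` of `X` — namely
`V = B₊(U) ∩ D(r)` for any `r` in the vertex ideal not vanishing at `x`, `h = t⁻¹`: there
`X'(V) = σˢ(X(U)) · S[1/r]` and `σˢ` is the `t⁻¹`-saturation of `X(U) · S` (Włodarczyk,
arXiv:2203.03090, Lemma 2.3.8: `E = V(t⁻¹)` on `B₊`; 3.3.12: `σˢ(I) = {f | t⁻ᵃ f ∈ 𝒪_B · I}`).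
[cite: Wlodarczyk2022, Lemma 2.3.8 and 3.3.12] -/
theorem stub_exceptional_principal :
    ∀ ⦃Y : Scheme.{0}⦄ (R : ReesAlgebraData Y) (U : Y.affineOpens) (X : Y.IdealSheafData)
      (x : (cobordantExceptional R U).subscheme),
      ∃ V : (R.cobordantPlus U).affineOpens,
        (cobordantExceptional R U).subschemeι x ∈ (V : (R.cobordantPlus U).Opens) ∧
        ∃ h : Γ(R.cobordantPlus U, V), (cobordantExceptional R U).ideal V = Ideal.span {h} ∧
          ∀ a : Γ(R.cobordantPlus U, V), h * a ∈ (R.cobordantStrictTransform U X).ideal V →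
            a ∈ (R.cobordantStrictTransform U X).ideal V := by
  intro Y R U X x
  haveI : IsAffine (affineCobordantBlowup (R.chartIdeals U)) := by
    unfold affineCobordantBlowup
    infer_instance
  -- notation: `I`, `S = extReesAlgebra I`, `B = Spec S`, `eΓ : Γ(B) ≅ S`
  set I := R.chartIdeals U
  set eΓ := Scheme.ΓSpecIso (.of (extReesAlgebra I))
  -- the point `x` of `B₊` is a prime of `S` off the vertex: pick `r` in the vertex ideal outside it
  have hxP : (x.1).1 ∈ affineCobordantBlowup.plusOpens I := x.1.2
  obtain ⟨r, hrv, hrx⟩ : ∃ r ∈ extReesAlgebra.vertexIdeal I, r ∉ (x.1.1).asIdeal :=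
    SetLike.not_le_iff_exists.mp ((OffExceptional.mem_plusOpens_iff I _).mp hxP)
  have hD : (affineCobordantBlowup I).basicOpen (eΓ.inv r) = PrimeSpectrum.basicOpen r :=
    basicOpen_eq_of_affine (R := .of (extReesAlgebra I)) r
  have hrP : (affineCobordantBlowup I).basicOpen (eΓ.inv r) ≤
      affineCobordantBlowup.plusOpens I := by
    rw [hD]
    intro q hq
    exact (OffExceptional.mem_plusOpens_iff I q).mpr fun hle => hq (hle hrv)
  have hb : (x.1).1 ∈ (affineCobordantBlowup I).basicOpen (eΓ.inv r) := by
    rw [hD]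
    exact hrx
  -- `σˢ(X(U))`, transported to `Γ(B)`, is `t⁻¹`-saturated
  have hσ : ∀ g, eΓ.inv (extReesAlgebra.tInv I) * g ∈
      (extReesAlgebra.strictTransform I (X.ideal U)).map eΓ.inv.hom →
      g ∈ (extReesAlgebra.strictTransform I (X.ideal U)).map eΓ.inv.hom :=
    mem_map_of_mul_mem_map_of_inverse eΓ.inv.hom eΓ.hom.hom (CommRingCat.hom_inv_apply eΓ)
      (CommRingCat.inv_hom_apply eΓ) (fun g hg => mem_strictTransform_of_tInv_mul_mem I hg)
  obtain ⟨V, hxV, h, hE, hreg⟩ := exists_affineOpens (affineCobordantBlowup.plusOpens I)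
    (eΓ.inv (extReesAlgebra.tInv I)) (eΓ.inv r) _ hσ hrP x.1 hb
  -- `E(U)` is the pull-back of the ideal sheaf of `(t⁻¹)`, i.e. of `span {eΓ⁻¹ t⁻¹}`
  have hEq : cobordantExceptional R U =
      (Scheme.IdealSheafData.ofIdealTop (Ideal.span {eΓ.inv (extReesAlgebra.tInv I)})).comap
        (affineCobordantBlowup.plusOpens I).ι := by
    change (Scheme.IdealSheafData.ofIdealTop
      ((Ideal.span {extReesAlgebra.tInv I}).map eΓ.inv.hom)).comap
        (affineCobordantBlowup.plusOpens I).ι = _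
    rw [Ideal.map_span, Set.image_singleton]
  refine ⟨V, hxV, h, ?_, hreg⟩
  rw [hEq]
  exact hE

end Summit.ResolutionOfSingularities.ResolutionOfSingularities.Theorems

end
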